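import Summits.QuantumFields.QCD.Theses.HeatSlicedQuarks

/-!
# Lead c3 (2026-08-16T18:3xZ): the chirality dichotomy for the re-typed crux
`HeatSlicedQuarks.RobustYangMillsHandover := ContinuumQCDExists → QCD` (stmt-QuantumFields-8892)

Kernel-checked against the CURRENT statement (re-type p117723, `QCDOf` conjoins `reg.IsChiralAtZero`), importing
ONLY the route module (nothing downstream of the pre-re-type `QCDOf` body, whose oleans on the farm are stale —
`GluonicCompletion.Negative.Threshold`, `RobustYangMillsHandover.Negative.GapClauses`).

Sharpening of lead c2's `FINDING-retype-chiral.md` / `RetypeImpact.lean`: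

* `hasLatticeMassGap_species_irrel` — the lattice gap clause reads only `(β_k, L_k, a_k, m_f(k))`, so it is decided by
  `(reg, m)`; `z, shift` are idle (definitional).
* `chiral_or_uniformLatticeGap` — EXCLUDED MIDDLE on the chirality of ANY regularisation: either `reg.IsChiralAtZero`,
  or there is ONE `ε > 0` such that the lattice theory of `reg` is uniformly gapped at EVERY positive mass tuple (for all
  species renormalisations).  Applied to the regularisation X₀ hands over: in the non-chiral branch the whole
  lattice-gap clause of the conjunct is FREE (uniform `ε`), but chirality is owed and cannot be read off `reg`; in the
  chiral branch chirality is free but gaps are owed at ALL positive masses of THAT regularisation, light regime included.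
  Either branch owes light-quark content — the dichotomy does not close the crux, it locates the new obligation.
* `not_isChiralAtZero_shift_of_uniformGapAbove` — a regularisation uniformly gapped above a threshold `M₀` has a
  threshold-shifted copy (`shiftReg`, realising the masses `M₀ + m`) that is provably NOT chiral at zero: the output of a
  heavy-threshold handover with a uniform gap REFUTES the chirality of the only regularisation it can name (with a
  non-uniform gap it merely fails to entail it).
* `hasLatticeMassGap_anti'` — monotonicity of the lattice gap clause (re-proved here; the tree copy sits in a stale module).
* Restatement algebra for option R2 (chirality moved into the antecedent): `ContinuumQCDExistsChiral` (X₀ with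
  `IsChiralAtZero` for the same `reg`), `SameRegGapSupply` (gaps at every positive mass for the regularisation and masses
  X₀^χ names — no `m_crit` shift is available any more), `qcd_of_chiral_of_supply`, `continuumQCDExistsChiral_of_qcd`,
  `continuumQCDExists_of_chiral`.  Option R1 (split into `HeavyHandover` + `ChiralCompletion`) is kernel-checked in c2's
  `RetypeImpact.lean` (`handover_iff_split`).

No new mathematics is claimed: these are definitional/logical facts recorded so that the planner's restatement can be
read off kernel-checked shapes.
-/

namespace Summit.QuantumFields.QCD.Cruxes.RobustYangMillsHandover.RetypeC3

open Filter
open Summit.QuantumFields.QCD.Theses.HeatSlicedQuarks (ContinuumQCDExists RobustYangMillsHandover)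
open Literature.MathematicalPhysics.QuantumFieldTheory

variable {Nf : ℕ}

/-! ## §1 The lattice gap clause is decided by `(reg, m)` -/

/-- `HasLatticeMassGap` reads only `β, L, a, mq` of the scheme, so the species renormalisations `z, shift` are idle
(definitional). [folklore] -/
theorem hasLatticeMassGap_species_irrel (reg : QCDRegularisation Nf) (m : Fin Nf → ℝ)
    (z shift : QCDField Nf → ℕ → ℝ) (Δ : ℝ) :
    (reg.scheme m z shift).HasLatticeMassGap Δ ↔ (reg.scheme m 0 0).HasLatticeMassGap Δ :=
  Iff.rfl

/-- Monotonicity of the lattice gap clause: a gap `Δ'` is a gap `Δ ≤ Δ'` (the constant is replaced by `max C 0`).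
[folklore] -/
theorem hasLatticeMassGap_anti' (sch : QCDScheme Nf) {Δ Δ' : ℝ} (hle : Δ ≤ Δ')
    (h : sch.HasLatticeMassGap Δ') : sch.HasLatticeMassGap Δ := by
  intro R R' A B
  obtain ⟨C, hC⟩ := h R R' A B
  refine ⟨max C 0, ?_⟩
  filter_upwards [hC] with k hk S hS n hn
  have h1 := hk S hS n hn
  have hexp : Real.exp (-(Δ' * (sch.a k * n))) ≤ Real.exp (-(Δ * (sch.a k * n))) := by
    apply Real.exp_le_exp.mpr
    have : 0 ≤ sch.a k * n := mul_nonneg (sch.a_pos k).le (Nat.cast_nonneg n)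
    nlinarith
  calc ‖qcdLatticeConnectedCorr (sch.β k) (2 * S + 1) (fun fl => sch.mq fl k) A B n‖
      ≤ C * Real.exp (-(Δ' * (sch.a k * n))) := h1
    _ ≤ max C 0 * Real.exp (-(Δ' * (sch.a k * n))) :=
        mul_le_mul_of_nonneg_right (le_max_left _ _) (Real.exp_pos _).le
    _ ≤ max C 0 * Real.exp (-(Δ * (sch.a k * n))) :=
        mul_le_mul_of_nonneg_left hexp (le_max_right _ _)

/-! ## §2 The chirality dichotomy -/

/-- **Excluded middle on chirality.** Every regularisation is either chiral at zero, or uniformly gapped on the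
lattice at EVERY positive mass tuple with ONE rate `ε > 0` (for all species renormalisations). [folklore] -/
theorem chiral_or_uniformLatticeGap (reg : QCDRegularisation Nf) :
    reg.IsChiralAtZero ∨
      ∃ ε > (0 : ℝ), ∀ m : Fin Nf → ℝ, (∀ f, 0 < m f) →
        ∀ z shift : QCDField Nf → ℕ → ℝ, (reg.scheme m z shift).HasLatticeMassGap ε := by
  by_cases h : reg.IsChiralAtZero
  · exact Or.inl h
  · refine Or.inr ?_
    unfold QCDRegularisation.IsChiralAtZero at h
    push Not at h
    obtain ⟨ε, hε, h⟩ := h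
    exact ⟨ε, hε, fun m hm z shift => (hasLatticeMassGap_species_irrel reg m z shift ε).mpr (h m hm)⟩

/-- The non-chiral branch, isolated: a regularisation that is NOT chiral at zero carries the conjunct's lattice-gap
clause at every positive mass for free, with a uniform rate. [folklore] -/
theorem uniformLatticeGap_of_not_chiral (reg : QCDRegularisation Nf) (h : ¬ reg.IsChiralAtZero) :
    ∃ ε > (0 : ℝ), ∀ m : Fin Nf → ℝ, (∀ f, 0 < m f) →
      ∀ z shift : QCDField Nf → ℕ → ℝ, (reg.scheme m z shift).HasLatticeMassGap ε :=
  (chiral_or_uniformLatticeGap reg).resolve_left h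

/-- Conversely, a uniform lattice gap at all positive masses refutes chirality at zero. [folklore] -/
theorem not_chiral_of_uniformLatticeGap (reg : QCDRegularisation Nf) {ε : ℝ} (hε : 0 < ε)
    (h : ∀ m : Fin Nf → ℝ, (∀ f, 0 < m f) → (reg.scheme m 0 0).HasLatticeMassGap ε) :
    ¬ reg.IsChiralAtZero := by
  intro hχ
  obtain ⟨m, hm, hng⟩ := hχ ε hε
  exact hng (h m hm)

/-! ## §3 Threshold shifts and chirality -/

/-- The regularisation with the flavour-blind critical mass shifted by `a_k M₀ / Z_m(k)`: it realises at renormalised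
masses `m` the scheme of `reg` at masses `M₀ + m`. [folklore] -/
noncomputable def shiftReg (reg : QCDRegularisation Nf) (M₀ : ℝ) : QCDRegularisation Nf :=
  { reg with mcrit := fun k => reg.mcrit k + reg.a k * M₀ / reg.Zm k }

/-- The shifted regularisation's scheme at `m` is the original scheme at `M₀ + m`. [folklore] -/
theorem shiftReg_scheme (reg : QCDRegularisation Nf) (M₀ : ℝ) (m : Fin Nf → ℝ)
    (z shift : QCDField Nf → ℕ → ℝ) :
    (shiftReg reg M₀).scheme m z shift = reg.scheme (fun f => M₀ + m f) z shift := by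
  simp only [shiftReg, QCDRegularisation.scheme, QCDScheme.mk.injEq, true_and, and_true]
  funext f k
  ring

/-- The shift does not touch `HasMassScaling` (which never reads `m_crit`). [folklore] -/
theorem shiftReg_hasMassScaling (reg : QCDRegularisation Nf) (M₀ : ℝ) :
    (shiftReg reg M₀).HasMassScaling ↔ reg.HasMassScaling :=
  Iff.rfl

/-- **A uniform gap above a threshold refutes the chirality of the shifted regularisation.** If `reg` is uniformly
gapped (rate `ε`) at every tuple with all masses `> M₀`, then `shiftReg reg M₀` — the only regularisation a
heavy-threshold handover can name for the conjunct — is NOT chiral at zero. [folklore] -/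
theorem not_isChiralAtZero_shift_of_uniformGapAbove (reg : QCDRegularisation Nf) (M₀ : ℝ) {ε : ℝ} (hε : 0 < ε)
    (h : ∀ m : Fin Nf → ℝ, (∀ f, M₀ < m f) → (reg.scheme m 0 0).HasLatticeMassGap ε) :
    ¬ (shiftReg reg M₀).IsChiralAtZero := by
  refine not_chiral_of_uniformLatticeGap (shiftReg reg M₀) hε fun m hm => ?_
  rw [shiftReg_scheme]
  exact h _ fun f => by linarith [hm f]

/-- Chirality of the shifted regularisation, unfolded: it asks for gapless-at-rate-`ε` points of the ORIGINAL
regularisation at masses `> M₀` — light-quark content relative to the unshifted offset. [folklore] -/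
theorem isChiralAtZero_shift_iff (reg : QCDRegularisation Nf) (M₀ : ℝ) :
    (shiftReg reg M₀).IsChiralAtZero ↔
      ∀ ε > (0 : ℝ), ∃ m : Fin Nf → ℝ, (∀ f, 0 < m f) ∧
        ¬ (reg.scheme (fun f => M₀ + m f) 0 0).HasLatticeMassGap ε := by
  unfold QCDRegularisation.IsChiralAtZero
  simp only [shiftReg_scheme]

/-! ## §4 What the re-typed conjunct asks of ONE regularisation -/

/-- The re-typed conjunct forces a single regularisation to be gapped at every positive mass tuple AND to have no
uniform gap: the per-mass gaps `Δ(m)` have infimum `0` over positive tuples (for every `ε` some positive tuple has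
`Δ(m) < ε`-behaviour). In particular the regularisation is NOT in the non-chiral branch of
`chiral_or_uniformLatticeGap`. [folklore] -/
theorem qcdOf_profile (h : QCDOf Nf) :
    ∃ reg : QCDRegularisation Nf, reg.HasMassScaling ∧ reg.IsChiralAtZero ∧
      (∀ m : Fin Nf → ℝ, (∀ f, 0 < m f) → ∃ Δ > 0, (reg.scheme m 0 0).HasLatticeMassGap Δ) ∧
      ¬ ∃ ε > (0 : ℝ), ∀ m : Fin Nf → ℝ, (∀ f, 0 < m f) → (reg.scheme m 0 0).HasLatticeMassGap ε := by
  obtain ⟨reg, hMS, hχ, hall⟩ := h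
  refine ⟨reg, hMS, hχ, fun m hm => ?_, ?_⟩
  · obtain ⟨z, shift, T, -, -, -, -, Δ, hΔ, -, hL⟩ := hall m hm
    exact ⟨Δ, hΔ, (hasLatticeMassGap_species_irrel reg m z shift Δ).mp hL⟩
  · rintro ⟨ε, hε, hgap⟩
    exact not_chiral_of_uniformLatticeGap reg hε hgap hχ

/-! ## §5 Restatement option R2: chirality on the antecedent side, handover for the SAME regularisation -/

/-- **X₀ with chirality** (`ContinuumQCDExists` whose regularisation is also `IsChiralAtZero`): the antecedent of the
handover if the engine (8891) is asked to tune `m_crit` to the chiral point. [folklore] -/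
def ContinuumQCDExistsChiral : Prop :=
  ∀ Nf : ℕ, Nf = 2 ∨ Nf = 3 → ∃ reg : QCDRegularisation Nf, reg.HasMassScaling ∧ reg.IsChiralAtZero ∧
    ∀ m : Fin Nf → ℝ, (∀ f, 0 < m f) →
      ∃ (z shift : QCDField Nf → ℕ → ℝ) (T : OSData (QCDField Nf) 4),
        IsQCDAlong (reg.scheme m z shift) T ∧ T.IsNontrivial QCDField.glue ∧
          T.IsNonGaussian QCDField.glue ∧ ∀ f g : Fin Nf, f ≠ g → T.IsNontrivial (QCDField.pseudoRe f g)

/-- **Same-regularisation gap supply at every positive mass**: for every chiral-pinned regularisation with mass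
scaling carrying honest continuum data at all positive masses, honest data WITH both gap clauses at every positive
mass of THAT regularisation (no threshold, no `m_crit` shift — chirality forbids it). This is what a handover must
deliver under option R2; it contains the light massive regime. [folklore] -/
def SameRegGapSupply : Prop :=
  ∀ Nf : ℕ, Nf = 2 ∨ Nf = 3 → ∀ reg : QCDRegularisation Nf, reg.HasMassScaling → reg.IsChiralAtZero →
    (∀ m : Fin Nf → ℝ, (∀ f, 0 < m f) →
      ∃ (z shift : QCDField Nf → ℕ → ℝ) (T : OSData (QCDField Nf) 4),
        IsQCDAlong (reg.scheme m z shift) T ∧ T.IsNontrivial QCDField.glue ∧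
          T.IsNonGaussian QCDField.glue ∧ ∀ f g : Fin Nf, f ≠ g → T.IsNontrivial (QCDField.pseudoRe f g)) →
    ∀ m : Fin Nf → ℝ, (∀ f, 0 < m f) →
      ∃ (z shift : QCDField Nf → ℕ → ℝ) (T : OSData (QCDField Nf) 4),
        IsQCDAlong (reg.scheme m z shift) T ∧ T.IsNontrivial QCDField.glue ∧
          T.IsNonGaussian QCDField.glue ∧ (∀ f g : Fin Nf, f ≠ g → T.IsNontrivial (QCDField.pseudoRe f g)) ∧
            ∃ Δ > 0, T.HasMassGap Δ ∧ (reg.scheme m z shift).HasLatticeMassGap Δ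

/-- Under option R2 the conjunct follows from the chiral antecedent and the same-regularisation supply (pure logic).
[folklore] -/
theorem qcd_of_chiral_of_supply (hX : ContinuumQCDExistsChiral) (hS : SameRegGapSupply) : _root_.QCD := by
  have key : ∀ Nf : ℕ, Nf = 2 ∨ Nf = 3 → QCDOf Nf := by
    intro Nf hNf
    obtain ⟨reg, hMS, hχ, hdata⟩ := hX Nf hNf
    exact ⟨reg, hMS, hχ, hS Nf hNf reg hMS hχ hdata⟩
  exact ⟨key 2 (Or.inl rfl), key 3 (Or.inr rfl)⟩

/-- The chiral antecedent is itself a consequence of the conjunct (drop the gap clauses), so option R2 loses nothing.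
[folklore] -/
theorem continuumQCDExistsChiral_of_qcd (h : _root_.QCD) : ContinuumQCDExistsChiral := by
  intro Nf hNf
  have hQ : QCDOf Nf := by
    rcases hNf with rfl | rfl
    · exact h.1
    · exact h.2
  obtain ⟨reg, hMS, hχ, hall⟩ := hQ
  refine ⟨reg, hMS, hχ, fun m hm => ?_⟩
  obtain ⟨z, shift, T, hA, hN, hG, hP, -⟩ := hall m hm
  exact ⟨z, shift, T, hA, hN, hG, hP⟩

/-- The chiral antecedent strengthens the route's X₀. [folklore] -/
theorem continuumQCDExists_of_chiral (h : ContinuumQCDExistsChiral) : ContinuumQCDExists := by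
  intro Nf hNf
  obtain ⟨reg, hMS, -, hdata⟩ := h Nf hNf
  exact ⟨reg, hMS, hdata⟩

/-- The crux as typed, read through R2: it is implied by "X₀ upgrades to X₀^χ" together with the same-regularisation
supply (pure logic) — the two new obligations the re-type created, named. [folklore] -/
theorem robustYangMillsHandover_of_upgrade_of_supply
    (hup : ContinuumQCDExists → ContinuumQCDExistsChiral) (hS : SameRegGapSupply) : RobustYangMillsHandover :=
  fun hX => qcd_of_chiral_of_supply (hup hX) hS

end Summit.QuantumFields.QCD.Cruxes.RobustYangMillsHandover.RetypeC3
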